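import Summits.CriticalPhenomena.PercolationContinuityZ3.Theorems.Transplant.SkelPhiEquilibriumWDefs
import Summits.CriticalPhenomena.PercolationContinuityZ3.Theorems.Transplant.SkelPhiOrientation
import HarnessLib

/-!
# N1 (the `{±1}` node), (R) column (N1-R-PLAN v2 §4 (R4b); NEG-SCOPE B.12/B.13): THE BRIDGE GEOMETRY IN PLAIN ORIENTED COORDINATES — the signed
# root frame `Skelφ.rootFrame φ t σ = (σ·(α − α_t), β − β_t)` (1-Lipschitz), and the READINGS into it of (i) the hop's landing piece (an x-family side
# half of the ROOT's long parallelogram: the box `{σ n} × (σh + τ[0, ℓ])`), (ii) any Step-I″ prism about a centre `c` (the box `c ± pgScale`, also for the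
# TRANSPOSED map `trφ φ`), (iii) the bridge stride's landing pieces in the three orientation cases of B.13 (same orientation: x-side half; transposed:
# x-side half / y′-top piece of `trφ φ`, read back through the coordinate swap), (iv) the pinned seed ball (`|coordinate 0| ≤ k`); plus graph radii

These are the pointwise facts that instantiate `ChainPlanar.BridgePrm` (KNParaRootBridge) and discharge, for the bridge step, the rooms of
`Skel.rootOblTWAt_of_chain₂` (SkelRootChainW): `T₀ ⊆ W(core 0)`, kit prisms `⊆ W(region)`, landings `⊆ W(core 1)`, regions off the seed ball.
builds on p205010 (kernel theorem, internal audit signed; external expert review pending) — nothing in this file uses p205010; nothing here is a claim about the open node.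
Lane `prim-bschramm`, seat `prim-bschramm-p3` (gen 9; design owner + (R) owner); helper file (`--supports stmt-CriticalPhenomena-4575 --as helper`).
[cite: MartineauTassion2017, §3.2 (the pieces L(a,u), L(u,b), L(v,b), L(−a,v) ⊂ R(a,b))] [cite: KozmaNitzan2024, §4 p. 28 ((32) at the root), Lemma 11 (pp. 22–23)]
-/

noncomputable section

open scoped Classical

namespace Summit.CriticalPhenomena.PercolationContinuityZ3.Theorems

namespace Transplant

namespace Skelφ

open Literature.Probability.Percolation Literature.Probability.LatticeModels SimpleGraph
open Literature.Barriers.CriticalPhenomena (graphBall mem_graphBall_self graphBall_mono)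

variable {V : Type} {G : SimpleGraph V} {φ : V → Site 2}

/-! ## §1 The signed root frame -/

/-- **The signed root frame**: `w ↦ (σ·(φ w 0 − φ t 0), φ w 1 − φ t 1)` — the skeleton coordinates relative to the root, the along-axis oriented by `σ = ±1`. [this work] -/
def rootFrame (φ : V → Site 2) (t : V) (σ : ℤ) : V → Site 2 := fun w i => if i = 0 then σ * (φ w 0 - φ t 0) else φ w 1 - φ t 1

/-- Coordinate `0` of the signed root frame. [folklore] -/
@[simp] theorem rootFrame_apply_zero (φ : V → Site 2) (t : V) (σ : ℤ) (w : V) : rootFrame φ t σ w 0 = σ * (φ w 0 - φ t 0) := rfl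

/-- Coordinate `1` of the signed root frame. [folklore] -/
@[simp] theorem rootFrame_apply_one (φ : V → Site 2) (t : V) (σ : ℤ) (w : V) : rootFrame φ t σ w 1 = φ w 1 - φ t 1 := rfl

/-- The root sits at the origin of its frame. [folklore] -/
@[simp] theorem rootFrame_self (φ : V → Site 2) (t : V) (σ : ℤ) : rootFrame φ t σ t = 0 := by
  funext i; fin_cases i <;> simp [rootFrame]

/-- **The signed root frame is 1-Lipschitz** (`σ = ±1`). [this work] -/
theorem lip_rootFrame (hlip : Lip G φ) (t : V) {σ : ℤ} (hσ : σ = 1 ∨ σ = -1) : Lip G (rootFrame φ t σ) := by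
  intro u v huv i
  fin_cases i
  · show |rootFrame φ t σ u 0 - rootFrame φ t σ v 0| ≤ 1
    rw [rootFrame_apply_zero, rootFrame_apply_zero, show σ * (φ u 0 - φ t 0) - σ * (φ v 0 - φ t 0) = σ * (φ u 0 - φ v 0) by ring, abs_mul,
      show |σ| = 1 by rcases hσ with h | h <;> simp [h], one_mul]
    exact hlip huv 0
  · show |rootFrame φ t σ u 1 - rootFrame φ t σ v 1| ≤ 1
    rw [rootFrame_apply_one, rootFrame_apply_one, show φ u 1 - φ t 1 - (φ v 1 - φ t 1) = φ u 1 - φ v 1 by ring]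
    exact hlip huv 1

/-- Differences in the root frame are differences of skeleton coordinates (coordinate `0` signed). [folklore] -/
theorem rootFrame_sub (φ : V → Site 2) (t : V) (σ : ℤ) (w c : V) :
    rootFrame φ t σ w 0 - rootFrame φ t σ c 0 = σ * (φ w 0 - φ c 0) ∧ rootFrame φ t σ w 1 - rootFrame φ t σ c 1 = φ w 1 - φ c 1 := by
  simp only [rootFrame_apply_zero, rootFrame_apply_one]; constructor <;> ring

/-! ## §2 Boxes -/

/-- The planar point `(a, b)`. [folklore] -/
def pt (a b : ℤ) : Site 2 := fun i => if i = 0 then a else b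

/-- Coordinate `0` of `pt`. [folklore] -/
@[simp] theorem pt_zero (a b : ℤ) : pt a b 0 = a := rfl

/-- Coordinate `1` of `pt`. [folklore] -/
@[simp] theorem pt_one (a b : ℤ) : pt a b 1 = b := by simp [pt]

/-- Membership in a box of the root frame, coordinatewise. [folklore] -/
theorem mem_Icc_pt_iff {x : Site 2} {a₀ b₀ a₁ b₁ : ℤ} : x ∈ Finset.Icc (pt a₀ a₁) (pt b₀ b₁) ↔ (a₀ ≤ x 0 ∧ x 0 ≤ b₀) ∧ (a₁ ≤ x 1 ∧ x 1 ≤ b₁) := by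
  rw [Finset.mem_Icc, Pi.le_def, Pi.le_def, Fin.forall_fin_two, Fin.forall_fin_two]
  simp only [pt_zero, pt_one]
  tauto

/-! ## §3 Reading an x-family side half (of `φ`) into the root frame -/

/-- **An x-side half read in the root frame**: `w ∈ pgSideHalfW G φ c n h ℓ R σ' τ` has `σ(α_w − α_c) = σσ'·n` and `β_w − β_c ∈ σ'h + τ·[0, ℓ]`; stated as the box
`rootFrame c + [lo, hi]` with `lo = (σσ'n, σ'h + min 0 (τℓ))`, `hi = (σσ'n, σ'h + max 0 (τℓ))`. [cite: MartineauTassion2017, §3.2 (L(a,u), L(u,b))] -/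
theorem rootFrame_mem_box_of_sideHalf [G.LocallyFinite] (t : V) {σ : ℤ} {n : ℕ} (hn : 1 ≤ n) {h : ℤ} {ℓ R : ℕ} {σ' τ : ℤ} (hτ : τ = 1 ∨ τ = -1) {c w : V}
    (hw : w ∈ pgSideHalfW G φ c n h ℓ R σ' τ) :
    rootFrame φ t σ w ∈ Finset.Icc (rootFrame φ t σ c + pt (σ * σ' * n) (σ' * h + min 0 (τ * ℓ))) (rootFrame φ t σ c + pt (σ * σ' * n) (σ' * h + max 0 (τ * ℓ))) := by
  rw [mem_pgSideHalfW] at hw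
  obtain ⟨-, hcyl, hα, hτβ⟩ := hw
  rw [mem_pgramCyl] at hcyl
  obtain ⟨-, hβ⟩ := hcyl
  simp only [relCoord_apply] at hα
  simp only [shearCoord_apply] at hβ hτβ
  have hn0 : (0 : ℤ) < n := by exact_mod_cast hn
  -- the transverse reading: `0 ≤ τ·n·(Δβ − σ'h) ≤ nℓ`
  have hx : (n : ℤ) * (φ w 1 - φ c 1) - h * (φ w 0 - φ c 0) = n * ((φ w 1 - φ c 1) - σ' * h) := by rw [hα]; ring
  rw [hx] at hβ hτβ
  have hd1 : min 0 (τ * ℓ) ≤ (φ w 1 - φ c 1) - σ' * h ∧ (φ w 1 - φ c 1) - σ' * h ≤ max 0 (τ * ℓ) := by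
    have hab := abs_le.1 hβ
    rcases hτ with rfl | rfl
    · rw [one_mul] at hτβ ⊢
      have h1 : 0 ≤ (φ w 1 - φ c 1) - σ' * h := nonneg_of_mul_nonneg_right (by linarith) hn0
      have h2 : (φ w 1 - φ c 1) - σ' * h ≤ ℓ := le_of_mul_le_mul_left (by linarith [hab.2]) hn0
      exact ⟨by rw [min_eq_left (by positivity)]; exact h1, by rw [max_eq_right (by positivity)]; exact h2⟩
    · have h1 : (φ w 1 - φ c 1) - σ' * h ≤ 0 := by nlinarith [hab.1]
      have h2 : -(ℓ : ℤ) ≤ (φ w 1 - φ c 1) - σ' * h := by nlinarith [hab.1]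
      refine ⟨?_, ?_⟩
      · rw [min_eq_right (by linarith : (-1 : ℤ) * ℓ ≤ 0)]; linarith
      · rw [max_eq_left (by linarith : (-1 : ℤ) * ℓ ≤ 0)]; exact h1
  have e : σ * (φ w 0 - φ t 0) = σ * (φ c 0 - φ t 0) + σ * σ' * n := by
    rw [show φ w 0 - φ t 0 = (φ c 0 - φ t 0) + (φ w 0 - φ c 0) by ring, hα]; ring
  rw [Finset.mem_Icc, Pi.le_def, Pi.le_def, Fin.forall_fin_two, Fin.forall_fin_two]
  simp only [Pi.add_apply, pt_zero, pt_one, rootFrame_apply_zero, rootFrame_apply_one]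
  exact ⟨⟨e.symm.le, by linarith [hd1.1]⟩, e.le, by linarith [hd1.2]⟩

/-! ## §4 Reading a prism (of `φ` or of `trφ φ`) into the root frame; graph radii -/

/-- **A prism of `φ` about `c` read in the root frame**: the box `rootFrame c ± pgScale n h ℓ`. [folklore] -/
theorem rootFrame_mem_box_of_prism [G.LocallyFinite] (t : V) {σ : ℤ} (hσ : σ = 1 ∨ σ = -1) {c w : V} {n : ℕ} {h : ℤ} {ℓ R : ℕ} (hw : w ∈ pgramPrism G φ c n h ℓ R) :
    rootFrame φ t σ w ∈ Finset.Icc (rootFrame φ t σ c - ((pgScale n h ℓ : ℕ) : Site 2)) (rootFrame φ t σ c + ((pgScale n h ℓ : ℕ) : Site 2)) := by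
  have hb := (mem_box.1 ((mem_cyl φ c _ w).1 (pgramPrism_subset_cyl c n h ℓ R hw)))
  have h0 := hb 0; have h1 := hb 1
  simp only [Pi.sub_apply] at h0 h1
  rw [Finset.mem_Icc, Pi.le_def, Pi.le_def, Fin.forall_fin_two, Fin.forall_fin_two]
  simp only [Pi.add_apply, Pi.sub_apply, Pi.natCast_apply, rootFrame_apply_zero, rootFrame_apply_one]
  rcases hσ with rfl | rfl <;> refine ⟨⟨?_, ?_⟩, ?_, ?_⟩ <;> linarith

/-- **A prism of the TRANSPOSED map `trφ φ` about `c` read in the root frame of `φ`**: the same box (the sup-norm is swap-invariant). [folklore] -/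
theorem rootFrame_mem_box_of_prism_tr [G.LocallyFinite] (t : V) {σ : ℤ} (hσ : σ = 1 ∨ σ = -1) {c w : V} {n : ℕ} {h : ℤ} {ℓ R : ℕ}
    (hw : w ∈ pgramPrism G (trφ φ) c n h ℓ R) :
    rootFrame φ t σ w ∈ Finset.Icc (rootFrame φ t σ c - ((pgScale n h ℓ : ℕ) : Site 2)) (rootFrame φ t σ c + ((pgScale n h ℓ : ℕ) : Site 2)) := by
  have hb := (mem_box.1 ((mem_cyl (trφ φ) c _ w).1 (pgramPrism_subset_cyl c n h ℓ R hw)))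
  have h0 := hb 0; have h1 := hb 1
  simp only [Pi.sub_apply, trφ_apply] at h0 h1
  have e0 : (0 : Fin 2).rev = 1 := rfl
  have e1 : (1 : Fin 2).rev = 0 := rfl
  rw [e0] at h0; rw [e1] at h1
  rw [Finset.mem_Icc, Pi.le_def, Pi.le_def, Fin.forall_fin_two, Fin.forall_fin_two]
  simp only [Pi.add_apply, Pi.sub_apply, Pi.natCast_apply, rootFrame_apply_zero, rootFrame_apply_one]
  rcases hσ with rfl | rfl <;> refine ⟨⟨?_, ?_⟩, ?_, ?_⟩ <;> linarith

/-- A prism about a centre of depth `≤ ρ` from `t` lies in `B_G(t, ρ + R)` (any map). [folklore] -/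
theorem mem_graphBall_of_mem_pgramPrism [G.LocallyFinite] {ψ : V → Site 2} {t c w : V} {ρ : ℕ} (hc : c ∈ graphBall G t ρ) {n : ℕ} {h : ℤ} {ℓ R : ℕ}
    (hw : w ∈ pgramPrism G ψ c n h ℓ R) : w ∈ graphBall G t (ρ + R) :=
  BoxProdZ2.mem_graphBall_add G hc ((mem_prism G ψ c R _ w).1 (cylBall_subset_prism G ψ c _ R (pgramPrism_subset_cylBall G ψ c n h ℓ R hw))).1

/-! ## §5 The bridge stride's landings in the three orientation cases -/

/-- **Case `o_b = o_L` (same map)**: the x-side half `pgSideHalfW G φ c n_b h_b ℓ_b R σ τ` of the bridge scale in direction `σ' = σ` read in the root frame: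
`rootFrame c + {n_b} × (σ h_b + τ[0, ℓ_b])` — along advance exactly `n_b`. [cite: MartineauTassion2017, §3.2] -/
theorem rootFrame_mem_box_of_sideHalf_same [G.LocallyFinite] (t : V) {σ : ℤ} (hσ : σ = 1 ∨ σ = -1) {n : ℕ} (hn : 1 ≤ n) {h : ℤ} {ℓ R : ℕ} {τ : ℤ} (hτ : τ = 1 ∨ τ = -1)
    {c w : V} (hw : w ∈ pgSideHalfW G φ c n h ℓ R σ τ) :
    rootFrame φ t σ w ∈ Finset.Icc (rootFrame φ t σ c + pt n (σ * h + min 0 (τ * ℓ))) (rootFrame φ t σ c + pt n (σ * h + max 0 (τ * ℓ))) := by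
  have hσσ : σ * σ = 1 := by rcases hσ with rfl | rfl <;> norm_num
  have := rootFrame_mem_box_of_sideHalf (G := G) t (σ := σ) hn hτ hw
  rwa [hσσ, one_mul] at this

/-- **Case `o_b ≠ o_L`, x-family**: the x-side half of the TRANSPOSED map `trφ φ` with `σ' = σ·s`, `s = sign h_b` surrogate (`s·h = |h|` supplied as `hs`), `τ = σ`, read in the root frame
of `φ`: coordinate `0` advances by `|h_b| + [0, ℓ_b]`, coordinate `1` moves by exactly `σ'·n_b` — along advance `≥ |h_b|`. [cite: MartineauTassion2017, §3.2] -/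
theorem rootFrame_mem_box_of_sideHalf_tr [G.LocallyFinite] (t : V) {σ : ℤ} (hσ : σ = 1 ∨ σ = -1) {n : ℕ} (hn : 1 ≤ n) {h : ℤ} {ℓ R : ℕ} {s : ℤ} (hs : s * h = |h|)
    {c w : V} (hw : w ∈ pgSideHalfW G (trφ φ) c n h ℓ R (σ * s) σ) :
    rootFrame φ t σ w ∈ Finset.Icc (rootFrame φ t σ c + pt |h| (σ * s * n)) (rootFrame φ t σ c + pt (|h| + ℓ) (σ * s * n)) := by
  rw [mem_pgSideHalfW] at hw
  obtain ⟨-, hcyl, hα, hτβ⟩ := hw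
  rw [mem_pgramCyl] at hcyl
  obtain ⟨-, hβ⟩ := hcyl
  simp only [relCoord_apply, trφ_apply] at hα
  simp only [shearCoord_apply, trφ_apply] at hβ hτβ
  have e0 : (0 : Fin 2).rev = 1 := rfl
  have e1 : (1 : Fin 2).rev = 0 := rfl
  rw [e0] at hα hβ hτβ; rw [e1] at hβ hτβ
  -- `hα : φ w 1 − φ c 1 = σ s n`; the transverse (for `trφ`) coordinate is `φ · 0`
  have hn0 : (0 : ℤ) < n := by exact_mod_cast hn
  have hσσ : σ * σ = 1 := by rcases hσ with rfl | rfl <;> norm_num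
  have hx : (n : ℤ) * (φ w 0 - φ c 0) - h * (φ w 1 - φ c 1) = n * ((φ w 0 - φ c 0) - σ * s * h) := by rw [hα]; ring
  rw [hx] at hβ hτβ
  -- `0 ≤ σ·n·(Δ − σ s h) ≤ nℓ` gives `σΔ ∈ s h + [0, ℓ] = |h| + [0, ℓ]`
  have hab := abs_le.1 hβ
  have key : 0 ≤ σ * (φ w 0 - φ c 0) - s * h ∧ σ * (φ w 0 - φ c 0) - s * h ≤ ℓ := by
    have hm : σ * (n * ((φ w 0 - φ c 0) - σ * s * h)) = n * (σ * (φ w 0 - φ c 0) - s * h) := by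
      have : σ * (σ * s * h) = s * h := by rw [← mul_assoc, ← mul_assoc, hσσ, one_mul]
      ring_nf; rw [show σ ^ 2 = σ * σ by ring, hσσ]; ring
    rw [hm] at hτβ
    refine ⟨nonneg_of_mul_nonneg_right (by linarith) hn0, le_of_mul_le_mul_left ?_ hn0⟩
    rcases hσ with rfl | rfl
    · nlinarith [hab.2, hab.1]
    · nlinarith [hab.2, hab.1]
  rw [hs] at key
  rw [Finset.mem_Icc, Pi.le_def, Pi.le_def, Fin.forall_fin_two, Fin.forall_fin_two]
  simp only [Pi.add_apply, pt_zero, pt_one, rootFrame_apply_zero, rootFrame_apply_one]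
  exact ⟨⟨by linarith [key.1], by linarith [hα]⟩, by linarith [key.2], by linarith [hα]⟩

/-- **Case `o_b ≠ o_L`, y′-family**: the top piece `pgTopPieceW G (trφ φ) c n h ℓ R σ τ v` of the transposed map read in the root frame of `φ`: coordinate `0` advances by at least
`ℓ − |h| − 11` (the layer's thickness `n + |h|` and tilt `|h|`, with `|h| ≤ 10n`) and at most `ℓ + |h|`, coordinate `1` moves by `∈ [−n, n]`. [cite: MartineauTassion2017, §3.2 (L(v,b), L(−a,v))] -/
theorem rootFrame_mem_box_of_topPiece_tr [G.LocallyFinite] (t : V) {σ : ℤ} (hσ : σ = 1 ∨ σ = -1) {n : ℕ} (hn : 1 ≤ n) {h : ℤ} (hκ : h.natAbs ≤ 10 * n) {ℓ R : ℕ} {τ v : ℤ}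
    {c w : V} (hw : w ∈ pgTopPieceW G (trφ φ) c n h ℓ R σ τ v) :
    rootFrame φ t σ w ∈ Finset.Icc (rootFrame φ t σ c + pt ((ℓ : ℤ) - |h| - 11) (-(n : ℤ))) (rootFrame φ t σ c + pt ((ℓ : ℤ) + |h|) n) := by
  rw [mem_pgTopPieceW] at hw
  obtain ⟨-, hcyl, hlay, -⟩ := hw
  rw [mem_pgramCyl] at hcyl
  obtain ⟨hαn, hβ⟩ := hcyl
  simp only [relCoord_apply, trφ_apply] at hαn
  simp only [shearCoord_apply, trφ_apply] at hβ hlay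
  have e0 : (0 : Fin 2).rev = 1 := rfl
  have e1 : (1 : Fin 2).rev = 0 := rfl
  rw [e0] at hαn hβ hlay; rw [e1] at hβ hlay
  -- names: `A := φ w 1 − φ c 1` (the transposed map's α; transverse for `φ`), `B := φ w 0 − φ c 0` (its β; along for `φ`)
  set A := φ w 1 - φ c 1 with hA
  set B := φ w 0 - φ c 0 with hB
  have hn0 : (0 : ℤ) < n := by exact_mod_cast hn
  have hAa := abs_le.1 hαn
  have hhB : |h * A| ≤ |h| * n := by rw [abs_mul]; exact mul_le_mul_of_nonneg_left hαn (abs_nonneg _)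
  have hhA := abs_le.1 hhB
  have hσσ : σ * σ = 1 := by rcases hσ with rfl | rfl <;> norm_num
  have habsσ : |σ| = 1 := by rcases hσ with rfl | rfl <;> norm_num
  have hβa := abs_le.1 hβ
  have hk : (h.natAbs : ℤ) = |h| := Int.natCast_natAbs h
  have hκ' : |h| ≤ 10 * (n : ℤ) := by rw [← hk]; exact_mod_cast hκ
  push_cast at hlay
  -- `X := σ(nB − hA) = n·σB − σ·hA`, `|σ·hA| ≤ |h|·n`, `nℓ − (n+|h|) < X ≤ nℓ`
  have h1 : σ * ((n : ℤ) * B - h * A) ≤ n * ℓ := by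
    rcases hσ with rfl | rfl <;> linarith [hβa.1, hβa.2]
  have h2 : σ * ((n : ℤ) * B - h * A) = n * (σ * B) - σ * (h * A) := by ring
  have h3 : |σ * (h * A)| ≤ |h| * n := by rw [abs_mul, habsσ, one_mul]; exact hhB
  have h4u := (abs_le.1 h3).2
  have h4l := (abs_le.1 h3).1
  have hY : (n : ℤ) * (σ * B) ≤ n * ℓ + |h| * n := by linarith
  have hY' : (n : ℤ) * ℓ - (n + |h|) - |h| * n < n * (σ * B) := by linarith
  have hupB : σ * B ≤ ℓ + |h| := by
    by_contra hc
    push Not at hc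
    have hm : (n : ℤ) * (ℓ + |h| + 1) ≤ n * (σ * B) := mul_le_mul_of_nonneg_left (by omega) hn0.le
    have e : (n : ℤ) * (ℓ + |h| + 1) = n * ℓ + |h| * n + n := by ring
    linarith
  have hloB : (ℓ : ℤ) - |h| - 11 ≤ σ * B := by
    by_contra hc
    push Not at hc
    have hm : (n : ℤ) * (σ * B) ≤ n * ((ℓ : ℤ) - |h| - 12) := mul_le_mul_of_nonneg_left (by omega) hn0.le
    have e : (n : ℤ) * ((ℓ : ℤ) - |h| - 12) = n * ℓ - |h| * n - 12 * n := by ring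
    have hκn : |h| * (1 : ℤ) ≤ 10 * n := by linarith
    nlinarith
  rw [Finset.mem_Icc, Pi.le_def, Pi.le_def, Fin.forall_fin_two, Fin.forall_fin_two]
  simp only [Pi.add_apply, pt_zero, pt_one, rootFrame_apply_zero, rootFrame_apply_one]
  refine ⟨⟨?_, by linarith [hAa.1]⟩, ?_, by linarith [hAa.2]⟩
  · have : σ * (φ w 0 - φ t 0) = σ * (φ c 0 - φ t 0) + σ * B := by rw [hB]; ring
    rw [this]; linarith
  · have : σ * (φ w 0 - φ t 0) = σ * (φ c 0 - φ t 0) + σ * B := by rw [hB]; ring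
    rw [this]; linarith

/-! ## §6 The pinned seed ball in the root frame -/

/-- **A vertex of a fat prism `cylBall G φ t k R` about the root has root-frame coordinate `0` in `[−k, k]`** (also for the transposed map, the sup-norm box being
swap-invariant) — so every window over a planar set whose coordinate-`0` range starts above `k` misses the pinned seed. [folklore] -/
theorem abs_rootFrame_zero_le_of_mem_cylBall [G.LocallyFinite] (t : V) {σ : ℤ} (hσ : σ = 1 ∨ σ = -1) {k R : ℕ} {w : V}
    (hw : w ∈ cylBall G φ t k R ∨ w ∈ cylBall G (trφ φ) t k R) : |rootFrame φ t σ w 0| ≤ k := by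
  have habsσ : |σ| = 1 := by rcases hσ with rfl | rfl <;> norm_num
  rw [rootFrame_apply_zero, abs_mul, habsσ, one_mul]
  rcases hw with hw | hw
  · have hb := mem_box.1 ((mem_cyl φ t k w).1 (cylBall_subset_cyl G φ t k R hw)) 0
    simp only [Pi.sub_apply] at hb
    exact abs_le.2 ⟨hb.1, hb.2⟩
  · have hb := mem_box.1 ((mem_cyl (trφ φ) t k w).1 (cylBall_subset_cyl G (trφ φ) t k R hw)) 1
    simp only [Pi.sub_apply, trφ_apply] at hb
    have e1 : (1 : Fin 2).rev = 0 := rfl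
    rw [e1] at hb
    exact abs_le.2 ⟨hb.1, hb.2⟩

/-- **Clearance**: a window `Win (rootFrame φ t σ) t Pl R'` over a planar set all of whose points have coordinate `0` `> k` is disjoint from both fat prisms of level `k` about
the root. [this work] -/
theorem disjoint_Win_rootFrame_cylBallFin [G.LocallyFinite] (t : V) {σ : ℤ} (hσ : σ = 1 ∨ σ = -1) {k R R' : ℕ} {Pl : Finset (Site 2)} (hPl : ∀ y ∈ Pl, (k : ℤ) < y 0)
    {ψ₀ : V → Site 2} (hψ₀ : ψ₀ = φ ∨ ψ₀ = trφ φ) :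
    Disjoint (Win G (rootFrame φ t σ) t Pl R') (cylBallFin G ψ₀ t k R) := by
  refine Finset.disjoint_left.2 fun w hw hw' => ?_
  rw [mem_cylBallFin] at hw'
  have hk : |rootFrame φ t σ w 0| ≤ k := by
    rcases hψ₀ with rfl | rfl
    · exact abs_rootFrame_zero_le_of_mem_cylBall (G := G) t hσ (Or.inl hw')
    · exact abs_rootFrame_zero_le_of_mem_cylBall (G := G) t hσ (Or.inr hw')
  have h1 := hPl _ ((mem_Win G _).1 hw).2
  have h2 := (abs_le.1 hk).2
  linarith

end Skelφ

end Transplant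

end Summit.CriticalPhenomena.PercolationContinuityZ3.Theorems

end
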